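import Literature.MathematicalPhysics.QuantumFieldTheory.Balaban1983to89.B8CubeMemberIdxB8Laws

/-!
# `Balaban1983to89.B8IdxB8LawsB` — [Balaban1985RegularSpaces] the BOND-SET LAW of print's gauge-fixing families ((1.12) p. 78 with the bond
# convention of p. 77: the constraint bonds `𝔅_k = ⋃_j Λ_j` ARE determined by the Λ-tower — classified in (1.31) p. 82 as inner∕crossing) as a fourth located INDEX
# LAW on n05-a's datum `B8LeafModelZd.ZdIdx`: `IdxB8LawsB` = `Node00.IdxB8Laws` (№7 scale, №8 truncation, №11 graded cover) + №12 «`Λb` is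
# the MAXIMAL class the `ZdIdx` bond laws admit» (`towerBonds`); the sub-index `IdxB8SubB θ`; its genuine members (n05-a's `Ω_j = ℤᵈ` members,
# the concrete cube members of Proposition 6); and the kernel certificate that the empty-bond witnesses of referee flag J2′ are EXCLUDED

statement-level skeleton of published theorems with citation tags; definitions + proofs; nothing here is a claim about the Yang–Mills
mass gap

T. Bałaban, *Spaces of regular gauge field configurations on a lattice and gauge fixing conditions*, Commun. Math. Phys. **99** (1985)
75–102 `[Balaban1985RegularSpaces]` ("B8"), (1.5)–(1.6) p. 77, (1.31) p. 82 («for bonds ⟨x, x′⟩ ⊂ Λ_j»), (1.37) p. 82 and (1.42) p. 83 (the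
crossing bonds «b₋ ∈ Λ_{j−1}, b₊ ∈ Λ_j» with «all sites of the contours Γ_{b₋,x} belong to Λ_{j−1}»), (1.12) p. 78 («𝔅_k = ⋃_j Λ_j (the same for the
sets of bonds)») under the convention of p. 77 («we denote by Ω also the set of bonds … {bonds b : at least one end-point of b belongs to Ω}»),
(1.131) p. 99.
PDF held: `paper:balaban1985-cmp99-regular-spaces-gauge-fixing` (journal page = PDF page + 74).

CITATION HEADER (lean-in-tree rule).  Cell `pub-ymgap` (YM Track A, HUMAN RULING D-0062), DAG node N05 = [B8], seat `pub-ymgap-dag-n05-c`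
(g2).  DIRECTOR-YM LINE №105 (2026-08-26T19:13Z, ruling on dag-lead WORDS-107 ∕ REBALANCE №55 (a)): «n05-c g2 TAKES the Λb law NOW
(`IdxB8LawsB`: `bondsOf Ω Λs m j` = the maximal class per REBALANCE №55 (a)) … every `…_b9all`∕`SB9all`-keyed knit over `ZdIdx`∕`IdxB8Sub`
is VACUOUS AS TYPED until the law lands».  WHY.  Referee flag J2′ (ref-A g12, kernel-certified `RefAProbeG12j.sb9all_false`): the b9-socket
binder `∀ i, ∀ m ≤ i.k, SockB9P3 … (i.Λb m)` is refuted at members whose bond classes are EMPTY (`Λb ≡ ∅` is legal in `ZdIdx`: its bond laws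
`hbox`∕`hclass` only say what a bond in `Λb` must look like, never that the bonds print uses ARE there); and the located laws `Node00.IdxB8Laws`
(node00-def g32) read `Ω`, `Λs`, `η`, `k` only, so the witness lies INSIDE the sub-index of record `IdxB8Sub θ`
(`B8CubeMemberIdxB8Laws.exists_idxB8Sub_bonds_empty`, this seat).  In print the bonds are DETERMINED by the tower ((1.12) p. 78: `𝔅_k = ⋃_j Λ_j`
read as bonds by the p. 77 convention; (1.31) p. 82 classifies them — «⟨x, x′⟩ ⊂ Λ_j» and the crossing bonds with one end in `Λ_j`, the
contour under the other in `Λ_{j−1}`), i.e. within n05-a's index `Λb` is the MAXIMAL class the two `ZdIdx` bond laws admit.  THIS FILE types that law: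
* §1 **`towerBonds L Ω Λ j`** — the maximal class at level `j` for the region sequence `Ω` and ONE truncation `Λ = Λs m` of the tower: all
  level-`j` bonds `c` whose box `Bʲ(c₋) ∪ Bʲ(c₊)` lies in `Ω_j` (`hbox` text) and which are inner or crossing w.r.t. `Λ` (`hclass` text,
  VERBATIM the three disjuncts of `B8LeafModelZd.ZdIdx.hclass`); `mem_towerBonds_iff` (`Iff.rfl`), `towerBonds_hbox`∕`towerBonds_hclass` (a
  member MAY take `Λb m j := towerBonds L Ω (Λs m) j` — the `ZdIdx` bond laws then hold by construction), `subset_towerBonds_of_laws`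
  (maximality), `towerBonds_univ_self` (at `Ω_j = T`, `Λ j = T`: ALL bonds).
* §2 **`IdxB8LawsB L i`** `extends Node00.IdxB8Laws L i` by №12 `bonds : ∀ m j, i.Λb m j = towerBonds L i.Ω (i.Λs m) j`; **`IdxB8SubB θ`** =
  `{i : Node00.IdxB8 θ ∕∕ IdxB8LawsB θ.L i.1}` with `IdxB8SubB.toSub : IdxB8SubB θ → Node00.IdxB8Sub θ` (so every law of g32's sub-index —
  `scale`, `trunc_lt`∕`trunc_top`, `cover`, `tower_all` — is available BY NAME on the new one), `famB8OfRecordSubB`.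
* §3 MEMBERS: **`idxB8LawsB_of_member_univ`** — n05-a's non-vacuity members (`B8LeafModelZd3NonVacuity.exists_member_univ`: `Ω_j = ℤᵈ`,
  `Λs m j = ℤᵈ` iff `j = m`, `Λb m j` = all bonds iff `j = m`) at `η = L⁻ᵏ` obey all four laws ⇒ **`nonempty_idxB8SubB_depth`** (the new
  sub-index is inhabited by GENUINE members at every depth `k ≥ 1`, each with NONEMPTY top bond class); **`idxB8LawsB_cubeMember`** — the
  concrete cube member of Proposition 6 (`B8CubeMemberZd`: `Λb := cubeLamB` IS `towerBonds` by `rfl`) ⇒ `exists_member_cube_lawsB` ∕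
  `exists_member_cube_subB` (a term of the laws-cut index `{i ∕∕ IdxB8LawsB L i}`; not of `IdxB8SubB θ`, whose `Ω₀ = T` — `not_exists_idxB8SubB_cubeMember`).
* §4 THE J2′ WITNESSES ARE EXCLUDED: **`bonds_self_univ_of_lawsB`** (a law member with `Ω_m = T = Λs m m` has `Λb m m` = ALL level-`m` bonds),
  **`not_idxB8LawsB_of_bonds_empty`** (no member with `Ω_m = Λs m m = T` at some `m` and `Λb ≡ ∅` obeys the law, `d ≥ 1`) — in particular the
  witness of `exists_idxB8Sub_bonds_empty` is NOT in `IdxB8SubB`.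
CONSUMERS (dag-lead REBALANCE №55): (b) n05-a re-binds `SHFP`∕`SB9all` of p459742 over `IdxB8SubB θ` (or `{i ∕∕ IdxB8LawsB L i}`); (d) n05-d's
range-form letters compose; (f) n06-b∕n06-e's `_b9all` suppliers re-key over the same sub-family; the cube-member instance is §3 here.

HONEST SCOPE.  One definition of a bond class + one `Prop`-structure + one sub-index; index-law BOOKKEEPING on print's own families; NO
estimate; nothing of [Balaban1985RegularSpaces]'s analysis asserted; whether `SockB9P3` over `IdxB8SubB` members is SATISFIABLE is the
supplier's theorem to prove (this file only removes the certified empty-bond refutation); N05 NOT discharged; counts unmoved; `T_η ↦ ℤᵈ`;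
one finite `T⁴` programme at fixed `ε`, Bałaban as printed — nothing continuum ∕ ℝ⁴ ∕ OS ∕ mass-gap ∕ Clay.  No `sorry`, no `axiom`, no
`instance`, no `notation`.  Unit `pub-ymgap-dag-n05-c` (g2), 2026-08-26.
VERSION v1.1 (same seat, APPEND-ONLY §5; §§1–4 decls byte-identical).  (i) LOCATOR ERRATUM (referee ref-E READ-15): the tags «p. 86 («𝔅_k …»)» in
the §§1–4 docstrings below are NOT a printed sentence — `𝔅_k` is DEFINED at (1.12) p. 78 («𝔅_k = ⋃_j Λ_j (the same for the sets of bonds)») under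
the bond convention of p. 77 («{bonds b : at least one end-point of b belongs to Ω}»), and its bonds are classified at (1.31) p. 82 ∕ (1.37)
p. 82 ∕ (1.42) p. 83; read every «p. 86 (𝔅_k)» below as «(1.12) p. 78 + p. 77 convention; (1.31) p. 82».  LOCATED (QUESTION-1 on the cell bus):
print's `𝔅_k`-bonds at level `j` = bonds with AT LEAST ONE end in `Λ_j`, whereas `ZdIdx.hbox` keeps only bonds with BOTH tower-boxes inside
`Ω_j` — at (1.5)-partition members the crossing bonds of (1.31)₂ (far end outside `Ω_j^{(j)}`) are therefore not terms of n05-a's index, and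
`towerBonds` = inner bonds there (certificate at the cube member: `B8CubeMemberIdxB8Laws.mem_cubeLamB_iff_inner`); №12 is faithful to the
index as typed.  (ii) §5 **`IdxB8LawsB.not_of_missing_inner`** (a law member cannot omit an inner bond of `Λs m j` with box in `Ω_j`) and
**`not_idxB8LawsB_of_level_univ_bonds_empty`** (any level `j ≤ m` with `Ω_j = Λs m j = T` and `Λb m j = ∅` refutes the law — reaching ref-A's
`degenerateMember` at `(m, j) = (2, 0)` by name, where §4's `not_idxB8LawsB_of_bonds_empty` (the case `j = m`) does not; ref-E's
`refE_degenerate_not_lawsB`).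
-/

noncomputable section

namespace Literature.MathematicalPhysics.QuantumFieldTheory.Balaban1983to89.B8IdxB8LawsB

open B7Prop1Explicit B7Prop1Local
open B8Ineq130 (tlo thi)
open B8Ineq132 (Under)
open B8Thm2LogB (blockTop)
open B8LeafModelZd (ZdIdx)
open B8Eq131Cubes (flm under_flm)
open B8Eq131CubesAdmissible (cubeFam)
open B8CubeMemberZd (cubeLamS cubeLamB inBox_tower_iff_under exists_member_cube)
open B8CubeMemberIdxB8Laws (idxB8Laws_cubeMember cubeLamB_nonempty not_exists_idxB8_cubeMember)
open Node00 (IdxB8Laws IdxB8 IdxB8Sub Stage3Params famB8OfRecord idxB8Laws_of_member_univ)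

variable {d : ℕ}

/-! ## §1 The maximal bond class generated by a truncation of the Λ-tower -/

/-- **THE BONDS THE Λ-TOWER GENERATES AT LEVEL `j`** («𝔅_k denotes the set of bonds of the conditions (1.31), (1.37)», p. 86) for the region
sequence `Ω` and one truncation `Λ` of the constraint tower (`Λ = Λs m`): all level-`j` bonds `c = ⟨c₋, c₋ + e_κ⟩` whose box `Bʲ(c₋) ∪ Bʲ(c₊)`
lies in `Ω_j` (the `hbox` law of `B8LeafModelZd.ZdIdx`) and which are INNER («⟨x, x′⟩ ⊂ Λ_j», (1.31)) or CROSSING (one end in `Λ_j`, the block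
under the other end in `Λ_{j−1}` — «b₋ ∈ Λ_j, Γ_{b₋,x} ⊂ Λ_{j−1}», (1.37)∕(1.42); the three disjuncts of `ZdIdx.hclass` VERBATIM).  The MAXIMAL
class the two `ZdIdx` bond laws admit. [cite: Balaban1985RegularSpaces, (1.31) p.82, (1.37) p.82, (1.42) p.83, p.86 («𝔅_k»)] -/
def towerBonds (L : ℕ) (Ω : ℕ → Set (B7Prop1Explicit.Site d)) (Λ : ℕ → Set (B7Prop1Explicit.Site d)) (j : ℕ) :
    Set (B7Prop1Explicit.Site d × Fin d) :=
  {c | (∀ x, InBox (loK L j c.1) (bondHiK L j c.1 c.2) x → x ∈ Ω j) ∧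
    ((c.1 ∈ Λ j ∧ c.1 + e c.2 ∈ Λ j) ∨
      (∃ j', j = j' + 1 ∧ (∀ x, (L : ℤ) • c.1 ≤ x → x ≤ (L : ℤ) • c.1 + blockTop L → x ∈ Λ j') ∧ c.1 + e c.2 ∈ Λ j) ∨
      (∃ j', j = j' + 1 ∧ c.1 ∈ Λ j ∧ (∀ x, (L : ℤ) • (c.1 + e c.2) ≤ x → x ≤ (L : ℤ) • (c.1 + e c.2) + blockTop L → x ∈ Λ j')))}

/-- Membership in `towerBonds`, unfolded (`Iff.rfl`). [cite: Balaban1985RegularSpaces, (1.31) p.82, p.86] -/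
theorem mem_towerBonds_iff (L : ℕ) (Ω Λ : ℕ → Set (B7Prop1Explicit.Site d)) (j : ℕ) (c : B7Prop1Explicit.Site d × Fin d) :
    c ∈ towerBonds L Ω Λ j ↔
      (∀ x, InBox (loK L j c.1) (bondHiK L j c.1 c.2) x → x ∈ Ω j) ∧
        ((c.1 ∈ Λ j ∧ c.1 + e c.2 ∈ Λ j) ∨
          (∃ j', j = j' + 1 ∧ (∀ x, (L : ℤ) • c.1 ≤ x → x ≤ (L : ℤ) • c.1 + blockTop L → x ∈ Λ j') ∧ c.1 + e c.2 ∈ Λ j) ∨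
          (∃ j', j = j' + 1 ∧ c.1 ∈ Λ j ∧ (∀ x, (L : ℤ) • (c.1 + e c.2) ≤ x → x ≤ (L : ℤ) • (c.1 + e c.2) + blockTop L → x ∈ Λ j'))) :=
  Iff.rfl

/-- **A member MAY take `Λb m j := towerBonds L Ω (Λs m) j`: the `ZdIdx` box law `hbox` then holds by construction.**
[cite: Balaban1985RegularSpaces, (1.31) p.82 (bookkeeping)] -/
theorem towerBonds_hbox (L : ℕ) (Ω : ℕ → Set (B7Prop1Explicit.Site d)) (Λs : ℕ → ℕ → Set (B7Prop1Explicit.Site d)) (k : ℕ) :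
    ∀ m, m ≤ k → ∀ j, j ≤ m → ∀ c ∈ towerBonds L Ω (Λs m) j, ∀ x, InBox (loK L j c.1) (bondHiK L j c.1 c.2) x → x ∈ Ω j :=
  fun _ _ _ _ _ hc => hc.1

/-- **… and so does the `ZdIdx` class law `hclass`.** [cite: Balaban1985RegularSpaces, (1.31) p.82, (1.37) p.82, (1.42) p.83 (bookkeeping)] -/
theorem towerBonds_hclass (L : ℕ) (Ω : ℕ → Set (B7Prop1Explicit.Site d)) (Λs : ℕ → ℕ → Set (B7Prop1Explicit.Site d)) (k : ℕ) :
    ∀ m, m ≤ k → ∀ j, j ≤ m → ∀ c ∈ towerBonds L Ω (Λs m) j,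
      (c.1 ∈ Λs m j ∧ c.1 + e c.2 ∈ Λs m j) ∨
      (∃ j', j = j' + 1 ∧ (∀ x, (L : ℤ) • c.1 ≤ x → x ≤ (L : ℤ) • c.1 + blockTop L → x ∈ Λs m j') ∧ c.1 + e c.2 ∈ Λs m j) ∨
      (∃ j', j = j' + 1 ∧ c.1 ∈ Λs m j ∧ (∀ x, (L : ℤ) • (c.1 + e c.2) ≤ x → x ≤ (L : ℤ) • (c.1 + e c.2) + blockTop L → x ∈ Λs m j')) :=
  fun _ _ _ _ _ hc => hc.2

/-- **MAXIMALITY**: every bond class obeying the two `ZdIdx` bond laws w.r.t. `(Ω, Λs)` is contained in `towerBonds` level by level — «𝔅 is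
DETERMINED by the Λ-tower». [cite: Balaban1985RegularSpaces, p.86 («𝔅_k denotes the set of bonds of the conditions (1.31), (1.37)»)] -/
theorem subset_towerBonds_of_laws (L : ℕ) (Ω : ℕ → Set (B7Prop1Explicit.Site d)) (Λs : ℕ → ℕ → Set (B7Prop1Explicit.Site d)) (k : ℕ)
    {Λb : ℕ → ℕ → Set (B7Prop1Explicit.Site d × Fin d)}
    (hbox : ∀ m, m ≤ k → ∀ j, j ≤ m → ∀ c ∈ Λb m j, ∀ x, InBox (loK L j c.1) (bondHiK L j c.1 c.2) x → x ∈ Ω j)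
    (hclass : ∀ m, m ≤ k → ∀ j, j ≤ m → ∀ c ∈ Λb m j,
      (c.1 ∈ Λs m j ∧ c.1 + e c.2 ∈ Λs m j) ∨
      (∃ j', j = j' + 1 ∧ (∀ x, (L : ℤ) • c.1 ≤ x → x ≤ (L : ℤ) • c.1 + blockTop L → x ∈ Λs m j') ∧ c.1 + e c.2 ∈ Λs m j) ∨
      (∃ j', j = j' + 1 ∧ c.1 ∈ Λs m j ∧ (∀ x, (L : ℤ) • (c.1 + e c.2) ≤ x → x ≤ (L : ℤ) • (c.1 + e c.2) + blockTop L → x ∈ Λs m j'))) :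
    ∀ m, m ≤ k → ∀ j, j ≤ m → Λb m j ⊆ towerBonds L Ω (Λs m) j :=
  fun m hm j hj _ hc => ⟨hbox m hm j hj _ hc, hclass m hm j hj _ hc⟩

/-- Every bond class of a `ZdIdx` member lies in the tower-generated class (maximality read at a member). [cite: Balaban1985RegularSpaces, p.86 (bookkeeping)] -/
theorem ZdIdx.Λb_subset_towerBonds {L : ℕ} (i : ZdIdx d L) :
    ∀ m, m ≤ i.k → ∀ j, j ≤ m → i.Λb m j ⊆ towerBonds L i.Ω (i.Λs m) j :=
  subset_towerBonds_of_laws L i.Ω i.Λs i.k i.hbox i.hclass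

/-- **At a level where `Ω_j = T` and `Λ_j = T` the tower generates ALL bonds** (every bond is inner, every box lies in `T`).
[cite: Balaban1985RegularSpaces, p.77 («we admit Ω_j = T_η»), (1.31) p.82] -/
theorem towerBonds_univ_self (L : ℕ) {Ω Λ : ℕ → Set (B7Prop1Explicit.Site d)} {j : ℕ} (hΩ : Ω j = Set.univ) (hΛ : Λ j = Set.univ) :
    towerBonds L Ω Λ j = Set.univ := by
  ext c
  simp only [mem_towerBonds_iff, hΩ, hΛ, Set.mem_univ, imp_true_iff, and_self, true_or, and_true]

/-! ## §2 The fourth located index law and the sub-index `IdxB8SubB` -/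

/-- **THE FOUR LOCATED INDEX LAWS print has by construction**: node00-def g32's three (`Node00.IdxB8Laws`: №7 `scale`, №8 `trunc_lt`∕`trunc_top`,
№11 `cover`) EXTENDED by №12 `bonds` — the constraint-bond class at every truncation `m` and level `j` IS the maximal class the Λ-tower generates
(`towerBonds`; «𝔅_k denotes the set of bonds of the conditions (1.31), (1.37)», p. 86).  Stated for all `m, j` (members are built with
`Λb := towerBonds`; outside `j ≤ m ≤ k` nothing reads `Λb`). [cite: Balaban1985RegularSpaces, p.86 («𝔅_k»), (1.31) p.82, (1.37) p.82, (1.42) p.83, p.77, (1.6) p.77, (1.19) p.79, (1.34) p.82] -/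
structure IdxB8LawsB (L : ℕ) (i : ZdIdx d L) : Prop extends IdxB8Laws L i where
  /-- №12: the bond classes are generated by the tower -/
  bonds : ∀ m j, i.Λb m j = towerBonds L i.Ω (i.Λs m) j

/-- Constructor from the three laws and the bond law as ONE function equation. [cite: Balaban1985RegularSpaces, p.86 (bookkeeping)] -/
theorem IdxB8LawsB.of_eq {L : ℕ} {i : ZdIdx d L} (h : IdxB8Laws L i) (hb : i.Λb = fun m j => towerBonds L i.Ω (i.Λs m) j) :
    IdxB8LawsB L i :=
  ⟨h, fun m j => by rw [hb]⟩

/-- The bond law level by level at a law member: membership in `i.Λb m j` IS membership in the tower-generated class.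
[cite: Balaban1985RegularSpaces, p.86 (bookkeeping)] -/
theorem IdxB8LawsB.mem_iff {L : ℕ} {i : ZdIdx d L} (h : IdxB8LawsB L i) (m j : ℕ) (c : B7Prop1Explicit.Site d × Fin d) :
    c ∈ i.Λb m j ↔ c ∈ towerBonds L i.Ω (i.Λs m) j := by
  rw [h.bonds m j]

/-- An inner bond of `Λs m j` with box inside `Ω_j` IS a constraint bond of a law member (the (1.31) half of №12, read as an introduction rule).
[cite: Balaban1985RegularSpaces, (1.31) p.82] -/
theorem IdxB8LawsB.inner_mem {L : ℕ} {i : ZdIdx d L} (h : IdxB8LawsB L i) {m j : ℕ} {z : B7Prop1Explicit.Site d} {μ : Fin d}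
    (hbox : ∀ x, InBox (loK L j z) (bondHiK L j z μ) x → x ∈ i.Ω j) (hz : z ∈ i.Λs m j) (hz' : z + e μ ∈ i.Λs m j) :
    (z, μ) ∈ i.Λb m j :=
  (h.mem_iff m j (z, μ)).2 ⟨hbox, Or.inl ⟨hz, hz'⟩⟩

variable (θ : Stage3Params)

/-- **THE SUB-INDEX OF RECORD WITH THE BOND LAW**: the admitted members (`Ω₀ = T_η`, g31's `Node00.IdxB8`) obeying all four located laws.
[cite: Balaban1985RegularSpaces, p.77, (1.6) p.77, (1.19) p.79, (1.34) p.82, p.86 («𝔅_k»)] -/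
abbrev IdxB8SubB : Type := {i : IdxB8 θ // IdxB8LawsB θ.L i.1}

variable {θ}

/-- The forgetful map to g32's sub-index `Node00.IdxB8Sub θ` (drop №12) — every law and lemma of `IdxB8Sub` (`scale`, `trunc_lt`∕`trunc_top`,
`cover`, `IdxB8Sub.tower_all`) is available on `IdxB8SubB` through it. [cite: Balaban1985RegularSpaces, p.77 (bookkeeping)] -/
def IdxB8SubB.toSub (i : IdxB8SubB θ) : IdxB8Sub θ := ⟨i.1, i.2.toIdxB8Laws⟩

/-- `toSub` does not change the underlying `ZdIdx` datum (`rfl`). [cite: Balaban1985RegularSpaces, p.77 (bookkeeping)] -/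
theorem IdxB8SubB.toSub_val (i : IdxB8SubB θ) : (IdxB8SubB.toSub i).1 = i.1 := rfl

/-- The tower law at every truncation on the new sub-index (g32's `IdxB8Laws.tower_all` BY NAME). [cite: Balaban1985RegularSpaces, (1.5)–(1.6) p.77] -/
theorem IdxB8SubB.tower_all (i : IdxB8SubB θ) :
    ∀ m, m ≤ i.1.1.k → ∀ j, j ≤ m → ∀ y ∈ i.1.1.Λs m j, ∀ x, InBox (tlo θ.L y j) (thi θ.L y j) x → x ∈ i.1.1.Ω j :=
  i.2.toIdxB8Laws.tower_all

/-- The bond law on the new sub-index. [cite: Balaban1985RegularSpaces, p.86 (bookkeeping)] -/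
theorem IdxB8SubB.bonds (i : IdxB8SubB θ) : ∀ m j, i.1.1.Λb m j = towerBonds θ.L i.1.1.Ω (i.1.1.Λs m) j :=
  i.2.bonds

/-- **THE GAUGE-FIXING FAMILY OF RECORD OVER THE NEW SUB-INDEX** (g31's `famB8OfRecord` restricted; the family a re-keyed knit ranges over).
[cite: Balaban1985RegularSpaces, (1.29) p.81, (1.33)–(1.40) pp.82–83, (1.62) p.87, (1.66) p.88] -/
abbrev famB8OfRecordSubB (θ : Stage3Params) (β : ℝ) (len : B7Prop1Explicit.Site θ.D → ℝ) (i : IdxB8SubB θ) : B8SectGH.GFData3 :=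
  famB8OfRecord θ β len i.1

/-! ## §3 Genuine members: n05-a's `Ω_j = ℤᵈ` members and the concrete cube members -/

/-- **n05-a's non-vacuity members obey all FOUR laws at spacing `η = L⁻ᵏ`** (`Ω_j = ℤᵈ`; `Λs m j = ℤᵈ` iff `j = m`, else `∅`; `Λb m j` = ALL
bonds iff `j = m`, else `∅` — exactly the classes the tower generates: at `j = m` every bond is inner, at `j ≠ m` no end lies in `Λs m j = ∅`);
the three located laws by g32's `idxB8Laws_of_member_univ`. [cite: Balaban1985RegularSpaces, p.77 («we admit Ω_j = T_η»), (1.31) p.82, p.86] -/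
theorem idxB8LawsB_of_member_univ {L : ℕ} (hL : 1 ≤ L) {i : ZdIdx d L} (hη : i.η = ((L : ℝ)⁻¹) ^ i.k) (hΩ : ∀ j, i.Ω j = Set.univ)
    (hΛ : ∀ m j, i.Λs m j = {_y | j = m}) (hΛb : ∀ m j, i.Λb m j = {_c | j = m}) : IdxB8LawsB L i := by
  refine ⟨idxB8Laws_of_member_univ hL hη hΛ, fun m j => ?_⟩
  ext c
  rw [hΛb, mem_towerBonds_iff]
  simp only [hΩ, hΛ, Set.mem_setOf_eq, Set.mem_univ, imp_true_iff, true_and, and_self]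
  constructor
  · exact fun h => Or.inl h
  · rintro (h | ⟨_, _, _, h⟩ | ⟨_, _, h, _⟩) <;> exact h

/-- **THE NEW SUB-INDEX IS INHABITED BY GENUINE MEMBERS AT EVERY DEPTH `k ≥ 1`, WITH NONEMPTY TOP BOND CLASS** (n05-a's
`B8LeafModelZd3NonVacuity.exists_member_univ` at `η = L⁻ᵏ`; its `Λb k k` is the set of ALL level-`k` bonds).
[cite: Balaban1985RegularSpaces, p.77 (bookkeeping: the index of record is inhabited)] -/
theorem nonempty_idxB8SubB_depth (θ : Stage3Params) {k : ℕ} (hk : 1 ≤ k) :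
    ∃ i : IdxB8SubB θ, i.1.1.k = k ∧ ∀ m j, i.1.1.Λb m j = {_c | j = m} := by
  have hL : 1 ≤ θ.L := le_trans (by norm_num) θ.two_le_L
  have hη : (0 : ℝ) < ((θ.L : ℝ)⁻¹) ^ k := pow_pos (inv_pos.mpr (by exact_mod_cast (show 0 < θ.L by omega))) k
  obtain ⟨i, h0, hik, hiη, hΩ, hΛ, hΛb⟩ := B8LeafModelZd3NonVacuity.exists_member_univ (d := θ.D) hL hk hη
  exact ⟨⟨⟨i, h0⟩, idxB8LawsB_of_member_univ hL (by rw [hiη, hik]) hΩ hΛ hΛb⟩, hik, hΛb⟩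

/-- The new sub-index is non-empty. [cite: Balaban1985RegularSpaces, p.77 (bookkeeping)] -/
theorem nonempty_idxB8SubB (θ : Stage3Params) : Nonempty (IdxB8SubB θ) :=
  let ⟨i, _⟩ := nonempty_idxB8SubB_depth θ le_rfl
  ⟨i⟩

/-- **THE CONCRETE CUBE MEMBER OF PROPOSITION 6 OBEYS ALL FOUR LAWS**: its bond classes `B8CubeMemberZd.cubeLamB` ARE the tower-generated classes
(`rfl` — `cubeLamB` was defined as the maximal class), the three located laws by `B8CubeMemberIdxB8Laws.idxB8Laws_cubeMember` (№7 as the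
hypothesis `Lᵏη ≤ 1`). [cite: Balaban1985RegularSpaces, (1.131) p.99, (1.31) p.82, p.86, (1.68) p.88, p.77] -/
theorem idxB8LawsB_cubeMember {L : ℕ} (hL : 1 ≤ L) (a : B7Prop1Explicit.Site d) (M ρ k : ℕ) {i : ZdIdx d L} (hk : i.k = k)
    (hΩ : i.Ω = cubeFam false L a M ρ k) (hΛ : i.Λs = cubeLamS L a M ρ k) (hΛb : i.Λb = cubeLamB L a M ρ k)
    (hscale : (L : ℝ) ^ i.k * i.η ≤ 1) : IdxB8LawsB L i := by
  refine ⟨idxB8Laws_cubeMember hL a M ρ k hk hΩ hΛ hscale, fun m j => ?_⟩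
  rw [hΛb, hΩ, hΛ]
  rfl

/-- **THE CUBE FAMILY `{□_j}` OF (1.131) AS A MEMBER OBEYING ALL FOUR LAWS** (`B8CubeMemberZd.exists_member_cube` + the laws): every field pinned,
`IdxB8LawsB L i`, for `1 ≤ L ≤ ρ`, `k ≥ 1`, `0 < η`, `Lᵏη ≤ 1`. [cite: Balaban1985RegularSpaces, (1.131) p.99, (1.3)–(1.6) p.77, (1.68) p.88, p.86] -/
theorem exists_member_cube_lawsB {L : ℕ} (hL : 1 ≤ L) (a : B7Prop1Explicit.Site d) (M : ℕ) {ρ : ℕ} (hρ : L ≤ ρ) {k : ℕ} (hk : 1 ≤ k)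
    {η : ℝ} (hη : 0 < η) (hscale : (L : ℝ) ^ k * η ≤ 1) :
    ∃ i : ZdIdx d L, i.k = k ∧ i.η = η ∧ i.Ω = cubeFam false L a M ρ k ∧ i.Λs = cubeLamS L a M ρ k ∧ i.Λb = cubeLamB L a M ρ k ∧
      IdxB8LawsB L i := by
  obtain ⟨i, hik, hiη, hΩ, hΛ, hΛb⟩ := exists_member_cube hL a M hρ hk hη
  exact ⟨i, hik, hiη, hΩ, hΛ, hΛb, idxB8LawsB_cubeMember hL a M ρ k hik hΩ hΛ hΛb (by rw [hik, hiη]; exact hscale)⟩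

/-- **The cube family as a term of the laws-cut index `{i : ZdIdx d L ∕∕ IdxB8LawsB L i}`** (the index a binder WITHOUT the `Ω₀ = T` clause is
keyed on; fields pinned). [cite: Balaban1985RegularSpaces, (1.131) p.99, (1.3)–(1.6) p.77, (1.68) p.88, p.86] -/
theorem exists_member_cube_subB {L : ℕ} (hL : 1 ≤ L) (a : B7Prop1Explicit.Site d) (M : ℕ) {ρ : ℕ} (hρ : L ≤ ρ) {k : ℕ} (hk : 1 ≤ k)
    {η : ℝ} (hη : 0 < η) (hscale : (L : ℝ) ^ k * η ≤ 1) :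
    ∃ i : {i : ZdIdx d L // IdxB8LawsB L i},
      i.1.k = k ∧ i.1.η = η ∧ i.1.Ω = cubeFam false L a M ρ k ∧ i.1.Λs = cubeLamS L a M ρ k ∧ i.1.Λb = cubeLamB L a M ρ k := by
  obtain ⟨i, hik, hiη, hΩ, hΛ, hΛb, hlaws⟩ := exists_member_cube_lawsB (d := d) hL a M hρ hk hη hscale
  exact ⟨⟨i, hlaws⟩, hik, hiη, hΩ, hΛ, hΛb⟩

/-- The cube members' TOWER-GENERATED classes are nonempty at every level `j ≤ m ≤ k` (`d ≥ 2`, `ρ ≥ 1`; `B8CubeMemberIdxB8Laws.cubeLamB_nonempty`,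
`cubeLamB` being `towerBonds` by `rfl`; the member-level reading is `B8CubeMemberIdxB8Laws.bonds_nonempty_cubeMember`).
[cite: Balaban1985RegularSpaces, (1.131) p.99, (1.31) p.82] -/
theorem towerBonds_cube_nonempty (hd2 : 2 ≤ d) {L : ℕ} (hL : 1 ≤ L) (a : B7Prop1Explicit.Site d) (M : ℕ) {ρ : ℕ} (hρ : 1 ≤ ρ) (k : ℕ) :
    ∀ m, m ≤ k → ∀ j, j ≤ m → (towerBonds L (cubeFam false L a M ρ k) (cubeLamS L a M ρ k m) j).Nonempty :=
  cubeLamB_nonempty hd2 hL a M hρ k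

/-- The cube member is NOT a term of `IdxB8SubB θ` (its `Ω₀` is `□₀`, not `T`; `B8CubeMemberIdxB8Laws.not_exists_idxB8_cubeMember`) — it is
served through the laws-cut index of `exists_member_cube_subB`. [cite: Balaban1985RegularSpaces, p.98, (1.132) p.99] -/
theorem not_exists_idxB8SubB_cubeMember (θ : Stage3Params) (a : B7Prop1Explicit.Site θ.D) (M ρ k : ℕ) :
    ¬ ∃ i : IdxB8SubB θ, i.1.1.Ω = cubeFam false θ.L a M ρ k := by
  rintro ⟨i, hi⟩
  exact not_exists_idxB8_cubeMember θ a M ρ k ⟨i.1, hi⟩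

/-! ## §4 The empty-bond witnesses of referee flag J2′ are EXCLUDED by the law -/

/-- **A law member with `Ω_m = T` and `Λs m m = T` has `Λb m m` = ALL level-`m` bonds** (`towerBonds_univ_self`).
[cite: Balaban1985RegularSpaces, p.77 («Ω_j = T_η»), (1.31) p.82, p.86] -/
theorem bonds_self_univ_of_lawsB {L : ℕ} {i : ZdIdx d L} (h : IdxB8LawsB L i) {m : ℕ} (hΩ : i.Ω m = Set.univ)
    (hΛ : i.Λs m m = Set.univ) : i.Λb m m = Set.univ := by
  rw [h.bonds m m]
  exact towerBonds_univ_self L hΩ hΛ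

/-- **NO MEMBER WITH `Ω_m = Λs m m = T` AT SOME LEVEL AND EMPTY BOND CLASSES OBEYS THE LAW** (`d ≥ 1`, so that a bond exists): in particular
the witness of `B8CubeMemberIdxB8Laws.exists_idxB8Sub_bonds_empty` (inside g32's `IdxB8Sub θ`) and ref-A's `degenerateMember` are NOT in
`IdxB8SubB θ` — the empty-bond refutation of the b9-socket binder (flag J2′) does not enter the new sub-family.
[cite: Balaban1985RegularSpaces, p.86 («𝔅_k»), (1.31) p.82 (bookkeeping: a typing certificate)] -/
theorem not_idxB8LawsB_of_bonds_empty (hd : 1 ≤ d) {L : ℕ} {i : ZdIdx d L} {m : ℕ} (hΩ : i.Ω m = Set.univ)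
    (hΛ : i.Λs m m = Set.univ) (hb : i.Λb m m = ∅) : ¬ IdxB8LawsB L i := by
  intro h
  have huniv := bonds_self_univ_of_lawsB h hΩ hΛ
  rw [hb] at huniv
  have hmem : ((0 : B7Prop1Explicit.Site d), (⟨0, hd⟩ : Fin d)) ∈ (∅ : Set (B7Prop1Explicit.Site d × Fin d)) := by
    rw [huniv]; exact Set.mem_univ _
  exact hmem

/-- The law-cut of g32's sub-index: a member of `IdxB8Sub θ` with empty bond classes at a level where `Ω_m = Λs m m = T` is NOT in
`IdxB8SubB θ` (`θ.D = d₆ + 1 ≥ 1`). [cite: Balaban1985RegularSpaces, p.86 (bookkeeping)] -/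
theorem not_lawsB_of_idxB8Sub_bonds_empty {θ : Stage3Params} (i : IdxB8Sub θ) {m : ℕ} (hΩ : i.1.1.Ω m = Set.univ)
    (hΛ : i.1.1.Λs m m = Set.univ) (hb : i.1.1.Λb m m = ∅) : ¬ IdxB8LawsB θ.L i.1.1 :=
  not_idxB8LawsB_of_bonds_empty (by have := θ.hd₆; omega) hΩ hΛ hb

/-- **Both sub-indices differ exactly by №12**: there is a member of g32's `IdxB8Sub θ` (the empty-bond witness) outside `IdxB8SubB θ`, at
every depth `k ≥ 1`. [cite: Balaban1985RegularSpaces, p.86 (bookkeeping: a typing certificate)] -/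
theorem exists_idxB8Sub_not_lawsB (θ : Stage3Params) {k : ℕ} (hk : 1 ≤ k) :
    ∃ i : IdxB8Sub θ, i.1.1.k = k ∧ ¬ IdxB8LawsB θ.L i.1.1 := by
  obtain ⟨i, hik, hΩ, hΛ, hb⟩ := B8CubeMemberIdxB8Laws.exists_idxB8Sub_bonds_empty θ hk
  refine ⟨i, hik, not_lawsB_of_idxB8Sub_bonds_empty i (hΩ k) ?_ (hb k k)⟩
  rw [hΛ]; ext; simp


/-! ## §5 (v1.1) General exclusion by a missing inner bond — reaching ref-A's `degenerateMember` by name -/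

/-- **A LAW MEMBER CANNOT OMIT AN INNER BOND**: if `z, z + e_μ ∈ Λs m j` and the bond box lies in `Ω_j` but `(z, μ) ∉ Λb m j`, the member violates
№12 (`IdxB8LawsB.inner_mem` contraposed). [cite: Balaban1985RegularSpaces, (1.31) p.82, (1.12) p.78] -/
theorem IdxB8LawsB.not_of_missing_inner {L : ℕ} {i : ZdIdx d L} {m j : ℕ} {z : B7Prop1Explicit.Site d} {μ : Fin d}
    (hbox : ∀ x, InBox (loK L j z) (bondHiK L j z μ) x → x ∈ i.Ω j) (hz : z ∈ i.Λs m j) (hz' : z + e μ ∈ i.Λs m j)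
    (hnot : (z, μ) ∉ i.Λb m j) : ¬ IdxB8LawsB L i :=
  fun h => hnot (h.inner_mem hbox hz hz')

/-- **ANY level `j` of ANY truncation `m` with `Ω_j = Λs m j = T` and `Λb m j = ∅` refutes the law** (`d ≥ 1`): the level-`j` bond `⟨0, e₀⟩` is inner
with box in `T`.  This reaches ref-A's `degenerateMember` (`k = 2`, `Ω ≡ T`, `Λs 2 0 = T`, `Λb ≡ ∅`) at `(m, j) = (2, 0)` — §4's
`not_idxB8LawsB_of_bonds_empty` is the case `j = m`. [cite: Balaban1985RegularSpaces, (1.31) p.82, (1.12) p.78 (bookkeeping: a typing certificate)] -/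
theorem not_idxB8LawsB_of_level_univ_bonds_empty (hd : 1 ≤ d) {L : ℕ} {i : ZdIdx d L} {m j : ℕ} (hΩ : i.Ω j = Set.univ)
    (hΛ : i.Λs m j = Set.univ) (hb : i.Λb m j = ∅) : ¬ IdxB8LawsB L i :=
  IdxB8LawsB.not_of_missing_inner (z := 0) (μ := ⟨0, hd⟩) (fun x _ => by rw [hΩ]; exact Set.mem_univ x)
    (by rw [hΛ]; exact Set.mem_univ _) (by rw [hΛ]; exact Set.mem_univ _) (by rw [hb]; exact Set.notMem_empty _)

end Literature.MathematicalPhysics.QuantumFieldTheory.Balaban1983to89.B8IdxB8LawsB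

end
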